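import Summits.PneNP.PneNP.Theorems.SymmetryBudgetNoHiddenOrderPerPathAtomsDefs
import Literature.Combinatorics.SimpleGraph.SwitchingEquivalentGraph

/-!
# `NoHiddenOrder` (stmt-PneNP-14781): bridges from the `W`-relative process vocabulary to the kit's semantics

Route `PneNP/SymmetryBudget`.  The per-path canoniser (PER-PATH.md, `…PerPath*.lean`) speaks the `W`-RELATIVE
vocabulary of `…BranchSumDefs` / `…PerPathAtomsDefs` on the ambient vertex type `V` (`BranchSum.cellOf`,
`BranchSum.blockEdges`, `BranchSum.swGraph G W c`, `BranchSum.swReach`), while the symmetric-compilation kit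
(`Literature/Computability/Complexity/SymmetricThresholdPrograms{Switching,Reach,…}.lean`) states the semantics of
its gadgets against the LITERATURE definitions on the induced SUBTYPE graph of the part
(`Literature.Combinatorics.SimpleGraph.swGraph (G.induce ↑W) (fun a => c a)`) and against
`Relation.ReflTransGen`.  This file identifies the two, so that an instantiation of the kit on the process
states is a matter of rewriting:

* `BranchSum.card_cellOf_eq_cellCard`, `BranchSum.blockEdges_eq_crossEdges`, `BranchSum.swComp_iff_switch`;
* `BranchSum.swGraph_adj_iff_induce` — for `u v ∈ W`: `(BranchSum.swGraph G W c).Adj u v ↔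
  (swGraph (G.induce ↑W) (c ∘ val)).Adj ⟨u,_⟩ ⟨v,_⟩` (the `Switching` gadget's `sem_sw_iff` target);
* `BranchSum.mem_swReach_iff_reflTransGen` — for `v ∈ B`: `b ∈ swReach G B c v ↔ Relation.ReflTransGen
  (fun a b => a ∈ B ∧ b ∈ B ∧ (swGraph G B c).Adj a b) v b` (the `Reach` gadget's `sem_r_last_iff` target, with
  `Mem := (· ∈ B)` and the `Switching` gadget's `sw` as edge wires).
Sorry-free; supports stmt-PneNP-14781, does not close it.
-/

set_option linter.dupNamespace false -- `Summit.PneNP.PneNP.…` (D-0017 single-conjunct layout)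

namespace Summit.PneNP.PneNP.Theorems

open Finset

namespace BranchSum

variable {V : Type*} [DecidableEq V] {G : SimpleGraph V} [DecidableRel G.Adj]

omit [DecidableEq V] in
/-- **Cells**: the `W`-relative cell of `u ∈ W` has the size of the colour class of `c u` in the subtype. [folklore] -/
theorem card_cellOf_eq_cellCard (W : Finset V) (c : V → ℕ) (u : V) :
    (cellOf W c u).card = Literature.Combinatorics.SimpleGraph.cellCard (fun a : ↥(W : Set V) => c a) (c u) := by
  unfold cellOf Literature.Combinatorics.SimpleGraph.cellCard
  refine Finset.card_bij (fun w hw => ⟨w, mem_coe.2 (mem_filter.1 hw).1⟩) ?_ ?_ ?_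
  · intro w hw; exact mem_filter.2 ⟨mem_univ _, (mem_filter.1 hw).2⟩
  · intro w _ w' _ h; exact congrArg Subtype.val h
  · rintro ⟨w, hwW⟩ hw
    exact ⟨w, mem_filter.2 ⟨mem_coe.1 hwW, (mem_filter.1 hw).2⟩, rfl⟩

omit [DecidableEq V] in
/-- **Blocks**: the `W`-relative edge count between the cells of `u, v` is the cross-edge count of the
induced subgraph. [folklore] -/
theorem blockEdges_eq_crossEdges (W : Finset V) (c : V → ℕ) (u v : V) :
    blockEdges G W c u v =
      Literature.Combinatorics.SimpleGraph.crossEdges (G.induce (W : Set V)) (fun a : ↥(W : Set V) => c a) (c u) (c v) := by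
  unfold blockEdges Literature.Combinatorics.SimpleGraph.crossEdges
  refine Finset.card_bij (fun p hp => (⟨p.1, mem_coe.2 (mem_filter.1 (mem_product.1 (mem_filter.1 hp).1).1).1⟩,
      ⟨p.2, mem_coe.2 (mem_filter.1 (mem_product.1 (mem_filter.1 hp).1).2).1⟩)) ?_ ?_ ?_
  · intro p hp
    obtain ⟨hp12, hadj⟩ := mem_filter.1 hp
    obtain ⟨h1, h2⟩ := mem_product.1 hp12
    refine mem_filter.2 ⟨mem_univ _, (mem_filter.1 h1).2, (mem_filter.1 h2).2, ?_⟩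
    exact hadj
  · intro p _ p' _ h
    simp only [Prod.mk.injEq, Subtype.mk.injEq] at h
    exact Prod.ext h.1 h.2
  · rintro ⟨⟨a, haW⟩, ⟨b, hbW⟩⟩ hab
    obtain ⟨-, hca, hcb, hadj⟩ := mem_filter.1 hab
    refine ⟨(a, b), mem_filter.2 ⟨mem_product.2 ⟨mem_filter.2 ⟨mem_coe.1 haW, hca⟩,
      mem_filter.2 ⟨mem_coe.1 hbW, hcb⟩⟩, hadj⟩, rfl⟩

omit [DecidableEq V] in
/-- **Switched blocks agree.** [folklore] -/
theorem swComp_iff_switch (W : Finset V) (c : V → ℕ) (u v : V) :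
    SwComp G W c u v ↔
      Literature.Combinatorics.SimpleGraph.Switch (G.induce (W : Set V)) (fun a : ↥(W : Set V) => c a) (c u) (c v) := by
  unfold SwComp Literature.Combinatorics.SimpleGraph.Switch
  rw [card_cellOf_eq_cellCard, card_cellOf_eq_cellCard, blockEdges_eq_crossEdges]

/-- **The switching-equivalent graphs agree on `W`**: the `W`-relative `BranchSum.swGraph G W c` and the
literature `swGraph` of the induced subgraph with the induced colouring. [folklore] -/
theorem swGraph_adj_iff_induce (W : Finset V) (c : V → ℕ) {u v : V} (hu : u ∈ W) (hv : v ∈ W) :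
    (swGraph G W c).Adj u v ↔
      (Literature.Combinatorics.SimpleGraph.swGraph (G.induce (W : Set V)) (fun a : ↥(W : Set V) => c a)).Adj
        ⟨u, mem_coe.2 hu⟩ ⟨v, mem_coe.2 hv⟩ := by
  rw [swGraph_adj]
  show u ≠ v ∧ (SwComp G W c u v ↔ ¬ G.Adj u v) ↔
    (⟨u, _⟩ : ↥(W : Set V)) ≠ ⟨v, _⟩ ∧ (G.Adj u v ↔ ¬ Literature.Combinatorics.SimpleGraph.Switch _ _ (c u) (c v))
  rw [← swComp_iff_switch]
  have hne : ((⟨u, mem_coe.2 hu⟩ : ↥(W : Set V)) ≠ ⟨v, mem_coe.2 hv⟩) ↔ u ≠ v :=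
    not_congr ⟨fun h => congrArg Subtype.val h, fun h => Subtype.ext h⟩
  rw [hne]
  refine and_congr_right fun _ => ?_
  tauto

/-! ### Reachable sets -/

/-- Every iterate of the expansion consists of vertices reachable from `v`. [folklore] -/
theorem reflTransGen_of_mem_iterate_swExpand {B : Finset V} (c : V → ℕ) (v : V) (n : ℕ) {b : V}
    (hb : b ∈ (swExpand G B c)^[n] ({v} ∩ B)) :
    Relation.ReflTransGen (fun a b => a ∈ B ∧ b ∈ B ∧ (swGraph G B c).Adj a b) v b := by
  induction n generalizing b with
  | zero =>
    simp only [Function.iterate_zero, id_eq, mem_inter, mem_singleton] at hb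
    rw [hb.1]
  | succ n ih =>
    rw [Function.iterate_succ_apply', swExpand, mem_union] at hb
    rcases hb with hb | hb
    · exact ih hb
    · obtain ⟨hbB, a, ha, hab⟩ := mem_filter.1 hb
      have haB : a ∈ B := iterate_swExpand_subset (G := G) c inter_subset_right n ha
      exact (ih ha).tail ⟨haB, hbB, hab⟩

/-- **`swReach` is reachability**: for `v ∈ B`, `b ∈ swReach G B c v` iff `b` is reachable from `v` by
switching edges (w.r.t. the partition of `B`) with both ends in `B`. [folklore] -/
theorem mem_swReach_iff_reflTransGen {B : Finset V} (c : V → ℕ) {v : V} (hv : v ∈ B) (b : V) :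
    b ∈ swReach G B c v ↔ Relation.ReflTransGen (fun a b => a ∈ B ∧ b ∈ B ∧ (swGraph G B c).Adj a b) v b := by
  constructor
  · exact reflTransGen_of_mem_iterate_swExpand c v _
  · intro h
    induction h with
    | refl => exact self_mem_swReach c hv
    | tail _ hab ih => exact swReach_closed c v ih hab.2.1 hab.2.2

end BranchSum

end Summit.PneNP.PneNP.Theorems
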